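import Literature.AnabelianGeometry.EtaleTheta.Discharge.Sec2Prop26ProfiniteTrueAtMonodromyModelB
import HarnessLib

/-!
# [EtTh] Prop. 2.6, PROFINITE clause («a similar statement holds when `Π^tp` is replaced by `Π`») HOLDS at the monodromy model:
# `(monodromyModel l hl).Prop26_profinite`, every odd `l` — the instance form of FACT-LIST F-0611 is INHABITED (proof-only)

S. Mochizuki, *The étale theta function and its Frobenioid-theoretic manifestations* [EtTh], Publ. RIMS **45** (2009), §2
Prop. 2.6, PRIMS p. 266 = PDF p. 40: «any isomorphism of topological groups `Π^tp_{Ẋ̲̲_α} ⥲ Π^tp_{Ẋ̲̲_β}` (respectively, `Ẋ̲`; `Ċ̲̲`;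
`Ċ̲`) induces isomorphisms compatible with the various natural maps between the respective "`Π^tp`'s" of `X̲̲` (respectively, `X̲`;
`C̲̲`; `C̲`) and `Ċ`. A similar statement holds when "`Π^tp`" is replaced by "`Π`".» [cite: MochizukiEtTh2009, Prop 2.6 p.40];
Rmk. 2.6.1 p. 40 (`Aut_K(Ẋ̲̲) = μ_l × {±1}`, …) [cite: MochizukiEtTh2009, Rmk 2.6.1 p.40].
Cell abc-iut, block F (FACT-proving wave), seat abc-iut-f-142 (gen 13), FACT-LIST row **F-0611**
`ThetaCovers.TemperedCoverData.Prop26_profinite` (the last sentence of Prop. 2.6 as typed by abc-iut-L2-t2; class «universal-closure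
REFUTED / schema», abc-iut-f-143; instance form returned OPEN-SIZED by abc-iut-f-108 g4) — INSTANCE at abc-iut-w6-d084's monodromy model
`monodromyModel l hl` (tempered twin PROVED there: `prop26_monodromyModel`).

WHAT IS PROVED. `aut_apply_zc`; **`exists_hatExtension_dotXu`** — case `Ẋ̲` (`Π_{Ẋ̲} = A = η⟨z⟩·R ≅ ℤ/l × Ẑ`): `γ(ηz) = ηz^k`,
`k ∈ (ℤ/l)ˣ`; `γ(ηt) = ηz^{c₀}·x₀` may SHEAR the loop into `η⟨z⟩`; `ρ(x) := γ(x)·ηz^{−c₀λ(x)}` (`λ = rotIdx ∘ Φ`) is a topological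
automorphism of `R` (continuous bijective homomorphism of the compact torsion-free `R`), and `γ = Σ_ρ ∘ (scaleAut k ∘ conj(x^{−c₀}))^∧` — the
shear is INNER; then **`prop26_profinite_monodromyModel : (monodromyModel l hl).Prop26_profinite`** (the four cases of parts A, B and this
file), `exists_temperedCoverData_prop26_profinite` (jointly with the tempered `Prop26` and `HasMuL`), the census pair
`prop26_profinite_instance_inhabited_and_closure_refuted` (instance INHABITED here, universal closure REFUTED by abc-iut-f-143's
`TemperedModel.not_forall_prop26_profinite`, every odd `l ≠ 1`) and the CLOSED twin `prop26_profinite_monodromyModel_three`.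
The route answers abc-iut-f-108 g4's sizing «MONODROMY `Π_C` COORDINATES» WITHOUT coordinates: universal property of Mathlib's
`ProfiniteGrp.ProfiniteCompletion` (scalings), density, the finite shadow `Φ`, components of the limit (torsion-freeness of `R`), and
abc-iut-w6-d084's tempered generators `scaleAut`, `halfShift`, `conj(x^a)` completed along `η`.

HONEST LABEL (abc-iut-L2-lead R1352, inherited from the carrier): «a DESIGNED tempered toy with print's monodromy combinatorics —
loop ↦ `Δ̄^ell` (`b`-cycle), the inversion INVERTS it, unipotent monodromy `x ↦ x·z` on the `a`-cycle, `z` = cusp inertia = `Δ̄_Θ`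
central; `G_K := 1`; NOT a Tate curve, NOT the tempered fundamental group of a curve; consistency ≠ faithfulness.» PROOF-ONLY
companion (0 `def`, 0 `instance`, 0 notation, 0 `Prop`-definition; nothing of abc-iut-w6-d084's model files or of abc-iut-L2-t2's
interface is edited or restated). Instance-at-OUR-carrier ≠ [EtTh] Prop. 2.6 for the profinite fundamental groups of a curve;
typed ≠ proved; no side is taken on [IUTchIII] Cor. 3.12 or on any author; nothing here asserts abc proved or refuted.
-/

noncomputable section

namespace Literature.AnabelianGeometry.EtaleTheta.ThetaCovers.MonodromyModel

open Multiplicative HeisenbergWitness TemperedModel DihedralGroup Topology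
open Literature.AnabelianGeometry.SemiGraphs

variable (l : ℕ)

/-! ## 1. The case `Ẋ̲` and the instance -/

section Cases

/-- **Automorphisms act on `η⟨z⟩` by a power map**: if `δ(η z) = η z^k` then `δ(η z^c) = η z^{k c}`. (toy bookkeeping; no claim
about print) [cite: MochizukiEtTh2009, Rmk 2.6.1 p.40] -/
theorem aut_apply_zc [NeZero l] {W : Subgroup (PiC l)} (hzcW : ∀ c, toHat l (embCu l (c, 1)) ∈ W) (δ : ↥W ≃ₜ* ↥W)
    (k : Multiplicative (ZMod l)) (hk : (δ ⟨toHat l (embCu l (ofAdd 1, 1)), hzcW _⟩ : PiC l) = toHat l (embCu l (k, 1)))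
    (c : Multiplicative (ZMod l)) :
    (δ ⟨toHat l (embCu l (c, 1)), hzcW c⟩ : PiC l) = toHat l (embCu l (ofAdd (toAdd k * toAdd c), 1)) := by
  have e1 : (⟨toHat l (embCu l (c, 1)), hzcW c⟩ : ↥W) = ⟨toHat l (embCu l (ofAdd 1, 1)), hzcW _⟩ ^ (toAdd c).val := by
    apply Subtype.ext; rw [SubgroupClass.coe_pow, ← map_pow, ← zc_eq_z_pow]
  rw [e1, map_pow, SubgroupClass.coe_pow, hk, ← map_pow, ← map_pow, Prod.pow_mk, one_pow]
  congr 3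
  apply toAdd.injective
  rw [toAdd_ofAdd, toAdd_pow, nsmul_eq_mul, ZMod.natCast_zmod_val, mul_comm]

/-- **Case `Ẋ̲`** (`Π_{Ẋ̲} = A = η⟨z⟩ · R ≅ ℤ/l × Ẑ`, abelian): every topological automorphism `γ` of `A` extends to `Π_C` stabilising the
closures of `Π^tp_{Ẋ̲}`, `Π^tp_{X̲}`, `Π^tp_Ċ`. Here `γ(η z) = η z^k` (`k ∈ (ℤ/l)ˣ`) and `γ(η t) = η z^{c₀} · x₀` (`x₀ ∈ R`) may SHEAR the
loop into `η⟨z⟩`; the map `ρ(x) := γ(x) · η z^{−c₀ λ(x)}` (`λ = rotIdx ∘ Φ`) is a topological automorphism of `R` (continuous bijective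
homomorphism of the compact group `R`: `R` torsion-free), and `γ = Σ_ρ ∘ (scaleAut k ∘ conj(x^{−c₀}))^∧` on `A` — the shear is INNER
(`conj(x^a) : t ↦ z^{−a} t`). (the typed [EtTh] Prop. 2.6, profinite clause, case `Ẋ̲`, AT THE MODEL; no claim about print)
[cite: MochizukiEtTh2009, Prop 2.6 p.40] -/
theorem exists_hatExtension_dotXu [NeZero l] {Z : Subgroup (TG l)} (hZ : Z = (heisB0 l ⊓ heisPiX l).comap (PhiT l))
    {A : Subgroup (PiC l)} (hA : A = ((Z ⊓ PiCdotT l).map (toHat l).toMonoidHom).topologicalClosure) (γ : ↥A ≃ₜ* ↥A) :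
    ∃ Γ : PiC l ≃ₜ* PiC l, (∀ h : ↥A, Γ h = γ h) ∧
      A.map Γ.toMulEquiv.toMonoidHom = A ∧
      ((Z.map (toHat l).toMonoidHom).topologicalClosure).map Γ.toMulEquiv.toMonoidHom =
        (Z.map (toHat l).toMonoidHom).topologicalClosure ∧
      (((PiCdotT l).map (toHat l).toMonoidHom).topologicalClosure).map Γ.toMulEquiv.toMonoidHom =
        ((PiCdotT l).map (toHat l).toMonoidHom).topologicalClosure := by
  subst hZ
  set R := ((Subgroup.zpowers (embCu l (1, r 1))).map (toHat l).toMonoidHom).topologicalClosure with hR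
  have hRcl : IsClosed (R : Set (PiC l)) := Subgroup.isClosed_topologicalClosure _
  have hRc : IsCompact (R : Set (PiC l)) := hRcl.isCompact
  have hzcA : ∀ c, toHat l (embCu l (c, 1)) ∈ A := fun c => by
    have := (mem_closure_dotXu_iff l hR hA _).mpr ⟨c, 1, R.one_mem, rfl⟩
    rwa [mul_one] at this
  have hRA : R ≤ A := fun y hy => by
    have := (mem_closure_dotXu_iff l hR hA (toHat l (embCu l (1, 1)) * y)).mpr ⟨1, y, hy, rfl⟩
    rwa [show ((1 : Multiplicative (ZMod l)), (1 : DihedralGroup 0)) = 1 from rfl, map_one, map_one, one_mul] at this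
  have htA : toHat l (embCu l (1, r 1)) ∈ A := hRA (toHat_t_mem l hR)
  -- Step 1: `γ(η z) = η z^k`, `k` a unit
  have hz : ∀ δ : ↥A ≃ₜ* ↥A, ∃ k : Multiplicative (ZMod l),
      (δ ⟨toHat l (embCu l (ofAdd 1, 1)), hzcA _⟩ : PiC l) = toHat l (embCu l (k, 1)) := by
    intro δ
    have hl' : (δ ⟨toHat l (embCu l (ofAdd 1, 1)), hzcA _⟩) ^ l = 1 := by
      rw [← map_pow, ← map_one δ, δ.apply_eq_iff_eq]
      exact Subtype.ext (by rw [SubgroupClass.coe_pow, ← map_pow, zc_pow_card, map_one]; rfl)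
    have hl'' := congrArg Subtype.val hl'
    rw [SubgroupClass.coe_pow] at hl''
    obtain ⟨k, x, hx, h⟩ := (mem_closure_dotXu_iff l hR hA _).mp (δ ⟨toHat l (embCu l (ofAdd 1, 1)), hzcA _⟩).2
    rw [h] at hl''
    refine ⟨k, ?_⟩
    rw [h, exists_eq_zc_of_pow_l_eq_one l hR k hx hl'', mul_one]
  obtain ⟨k, hk⟩ := hz γ
  obtain ⟨k', hk'⟩ := hz γ.symm
  have hkk' : toAdd k' * toAdd k = 1 := toAdd_mul_eq_one_of_zc_aut l (hzcA _) γ k k' hk hk'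
  let uk : (ZMod l)ˣ := Units.mkOfMulEqOne (toAdd k) (toAdd k') (by rw [mul_comm]; exact hkk')
  have huk : ((uk : (ZMod l)ˣ) : ZMod l) = toAdd k := rfl
  -- Step 2: `γ(η t) = η z^{c₀} · x₀`
  obtain ⟨c₀, x₀, hx₀, h0⟩ := (mem_closure_dotXu_iff l hR hA _).mp (γ ⟨toHat l (embCu l (1, r 1)), htA⟩).2
  -- Step 3: the twisted map `ρ(x) = γ(x) · η z^{-c₀ λ(x)}`
  let χ : PiC l → PiC l := fun x => toHat l (embCu l (ofAdd (-(rotIdx l (Phi l x).right * toAdd c₀)), 1))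
  have hχc : Continuous χ := by
    have e : χ = (fun a : ZMod l => toHat l (embCu l (ofAdd (-(a * toAdd c₀)), 1))) ∘ fun x => rotIdx l (Phi l x).right := rfl
    rw [e]; exact continuous_of_discreteTopology.comp (continuous_rotIdx_Phi l)
  have hχmul : ∀ x y, x ∈ R → y ∈ R → χ (x * y) = χ x * χ y := fun x y hx hy => by
    change toHat l _ = toHat l _ * toHat l _
    rw [← map_mul, ← map_mul, Prod.mk_mul_mk, mul_one, ← ofAdd_add, rotIdx_Phi_mul_of_mem_rot l hR hx hy]
    congr 3; ring
  have hχone : χ 1 = 1 := by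
    change toHat l _ = 1
    rw [map_one, SemidirectProduct.one_right, rotIdx_one, zero_mul, neg_zero, ofAdd_zero, ← Prod.one_eq_mk, map_one, map_one]
  have hχt : toHat l (embCu l (c₀, 1)) * χ (toHat l (embCu l (1, r 1))) = 1 := by
    change toHat l _ * toHat l _ = 1
    rw [rotIdx_Phi_toHat_t, one_mul, ← map_mul, ← map_mul, Prod.mk_mul_mk, mul_one,
      show c₀ * ofAdd (-toAdd c₀) = 1 from by apply toAdd.injective; rw [toAdd_mul, toAdd_ofAdd, toAdd_one, add_neg_cancel],
      ← Prod.one_eq_mk, map_one, map_one]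
  have hχpow : ∀ x : PiC l, (χ x) ^ l = 1 := fun x => by
    change toHat l _ ^ l = 1; rw [← map_pow, zc_pow_card, map_one]
  have hcomm : ∀ (x q : PiC l), q * χ x = χ x * q := fun x q => (toHat_zc_comm l _ q).symm
  have hχinv : ∀ x, (χ x)⁻¹ = toHat l (embCu l ((ofAdd (-(rotIdx l (Phi l x).right * toAdd c₀)))⁻¹, 1)) := fun x => by
    change (toHat l _)⁻¹ = _; rw [← map_inv, ← map_inv, Prod.inv_mk, inv_one]
  have hcomm' : ∀ (x q : PiC l), q * (χ x)⁻¹ = (χ x)⁻¹ * q := fun x q => by rw [hχinv]; exact (toHat_zc_comm l _ q).symm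
  let fR : ↥R →* PiC l :=
    { toFun := fun x => (γ ⟨x, hRA x.2⟩ : PiC l) * χ x
      map_one' := by
        rw [show (⟨((1 : ↥R) : PiC l), hRA (1 : ↥R).2⟩ : ↥A) = 1 from Subtype.ext rfl, map_one, OneMemClass.coe_one,
          OneMemClass.coe_one, hχone, mul_one]
      map_mul' := fun x y => by
        rw [show (⟨((x * y : ↥R) : PiC l), hRA (x * y).2⟩ : ↥A) = ⟨x, hRA x.2⟩ * ⟨y, hRA y.2⟩ from Subtype.ext rfl, map_mul,
          Subgroup.coe_mul, Subgroup.coe_mul, hχmul _ _ x.2 y.2]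
        have hc : Commute (γ ⟨y, hRA y.2⟩ : PiC l) (χ x) := hcomm x (γ ⟨y, hRA y.2⟩ : PiC l)
        exact hc.mul_mul_mul_comm _ _ }
  have hfR : ∀ x : ↥R, fR x = (γ ⟨x, hRA x.2⟩ : PiC l) * χ x := fun x => rfl
  have hfRc : Continuous fR :=
    (continuous_subtype_val.comp (γ.continuous.comp (continuous_subtype_val.subtype_mk _))).mul (hχc.comp continuous_subtype_val)
  have hfRt : fR ⟨toHat l (embCu l (1, r 1)), toHat_t_mem l hR⟩ = x₀ := by
    rw [hfR]
    change (γ ⟨toHat l (embCu l (1, r 1)), htA⟩ : PiC l) * χ (toHat l (embCu l (1, r 1))) = x₀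
    rw [h0, show toHat l (embCu l (c₀, 1)) * x₀ * χ _ = x₀ * (toHat l (embCu l (c₀, 1)) * χ (toHat l (embCu l (1, r 1)))) by
      rw [toHat_zc_comm l c₀ x₀]; group, hχt, mul_one]
  have hfRtk : ∀ j : ℤ, fR ⟨toHat l (embCu l (1, r 1) ^ j), toHat_t_zpow_mem l hR j⟩ = x₀ ^ j := fun j => by
    rw [show (⟨toHat l (embCu l (1, r 1) ^ j), toHat_t_zpow_mem l hR j⟩ : ↥R) = ⟨toHat l (embCu l (1, r 1)), toHat_t_mem l hR⟩ ^ j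
      from Subtype.ext (by simp only [SubgroupClass.coe_zpow, map_zpow]), map_zpow, hfRt]
  -- `fR` maps into `R`
  have hfRmem : ∀ x : ↥R, fR x ∈ R := fun x =>
    closed_subset_closure_eq_univ ((Subgroup.zpowers (embCu l (1, r 1))).map (toHat l).toMonoidHom) (P := fR ⁻¹' (R : Set (PiC l)))
      (hRcl.preimage hfRc) (fun y hy => by
        obtain ⟨j, rfl⟩ := (mem_map_zpowers_iff l).mp hy
        change fR ⟨toHat l (embCu l (1, r 1) ^ j), _⟩ ∈ R
        rw [hfRtk]
        exact R.zpow_mem hx₀ j) x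
  let fR' : ↥R →* ↥R := fR.codRestrict R hfRmem
  -- injective
  have hinj : Function.Injective fR' := by
    rw [← MonoidHom.ker_eq_bot_iff, Subgroup.eq_bot_iff_forall]
    intro x hx
    rw [MonoidHom.mem_ker] at hx
    have hx' : fR x = 1 := congrArg Subtype.val hx
    rw [hfR, mul_eq_one_iff_eq_inv] at hx'
    have h2 : (γ ⟨x, hRA x.2⟩) ^ l = 1 := by
      apply Subtype.ext; rw [SubgroupClass.coe_pow, hx', inv_pow, hχpow, inv_one]; rfl
    rw [← map_pow, ← map_one γ, γ.apply_eq_iff_eq] at h2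
    have h3 : (x : PiC l) ^ l = 1 := by have := congrArg Subtype.val h2; rwa [SubgroupClass.coe_pow] at this
    exact Subtype.ext (eq_one_of_pow_eq_one_of_mem_rot l hR x.2 (NeZero.ne l) h3)
  -- surjective
  have hsurj : Function.Surjective fR' := by
    intro r'
    obtain ⟨c, y, hy, hcy⟩ := (mem_closure_dotXu_iff l hR hA _).mp (γ.symm ⟨r', hRA r'.2⟩).2
    refine ⟨⟨y, hy⟩, Subtype.ext ?_⟩
    change fR ⟨y, hy⟩ = r'
    have e1 : γ.symm ⟨r', hRA r'.2⟩ = ⟨toHat l (embCu l (c, 1)), hzcA c⟩ * ⟨y, hRA hy⟩ := Subtype.ext hcy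
    have e2 := congrArg (fun q => ((γ q : ↥A) : PiC l)) e1
    simp only [ContinuousMulEquiv.apply_symm_apply, map_mul, Subgroup.coe_mul] at e2
    rw [aut_apply_zc l hzcA γ k hk c] at e2
    -- `r' = η z^{kc} · γ(y)` and `γ(y) = fR y · χ(y)⁻¹`
    have e3 : (γ ⟨y, hRA hy⟩ : PiC l) = fR ⟨y, hy⟩ * (χ y)⁻¹ := by rw [hfR, mul_inv_cancel_right]
    set d := toHat l (embCu l (ofAdd (toAdd k * toAdd c), 1)) * (χ y)⁻¹ with hd
    have hr' : (r' : PiC l) = d * fR ⟨y, hy⟩ := by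
      rw [e2, e3, hd, mul_assoc, hcomm' y (fR ⟨y, hy⟩)]
    -- the `η⟨z⟩`-factor `d` lies in `R`, hence is trivial
    have hdR : d ∈ R := by
      have : d = (r' : PiC l) * (fR ⟨y, hy⟩)⁻¹ := by rw [hr', mul_inv_cancel_right]
      rw [this]; exact R.mul_mem r'.2 (R.inv_mem (hfRmem _))
    have hdl : d ^ l = 1 := by
      have hcd : Commute (toHat l (embCu l (ofAdd (toAdd k * toAdd c), 1))) (χ y)⁻¹ := hcomm' y _
      rw [hd, hcd.mul_pow, inv_pow, hχpow, inv_one, mul_one, ← map_pow, zc_pow_card, map_one]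
    rw [hr', eq_one_of_pow_eq_one_of_mem_rot l hR hdR (NeZero.ne l) hdl, one_mul]
  haveI : CompactSpace ↥R := isCompact_iff_compactSpace.mp hRc
  let eρ : ↥R ≃ ↥R := Equiv.ofBijective fR' ⟨hinj, hsurj⟩
  have heρc : Continuous eρ := hfRc.subtype_mk _
  let hρ : ↥R ≃ₜ ↥R := heρc.homeoOfEquivCompactToT2
  let ρ : ↥R ≃ₜ* ↥R := ContinuousMulEquiv.mk' hρ fun x y => map_mul fR' x y
  have hρfR : ∀ x : ↥R, (ρ x : PiC l) = fR x := fun x => rfl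
  -- Step 4: scaling correction and tempered part
  obtain ⟨Sg, hSR, -, -, -, ⟨u, hSinl⟩, hSstab⟩ := exists_hatScalingEquiv_stabilising l hR ρ
  have hAc := coordClosed_inf l (coordClosed_heisB0 l) (coordClosed_heisPiX l)
  rw [← Subgroup.comap_inf] at hAc
  have hSA : A.map Sg.toMulEquiv.toMonoidHom = A := by rw [hA]; exact hSstab _ (coordClosed_inf l hAc (coordClosed_PiCdotT l))
  let Γ₀ : TG l ≃* TG l := (scaleAut l uk).trans (MulAut.conj (xElt l (-toAdd c₀)))
  have hΓ₀z : ∀ c : Multiplicative (ZMod l), Γ₀ (embCu l (c, 1)) = embCu l (ofAdd (toAdd k * toAdd c), 1) := fun c => by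
    change MulAut.conj (xElt l (-toAdd c₀)) (scaleAut l uk (embCu l (c, 1))) = _
    rw [scaleAut_embCu, huk, one_def, MulAut.conj_apply, conj_xElt_embCu_r, map_zero, zero_mul, sub_zero]
  have hΓ₀t : Γ₀ (embCu l (1, r 1)) = embCu l (c₀, 1) * embCu l (1, r 1) := by
    change MulAut.conj (xElt l (-toAdd c₀)) (scaleAut l uk (embCu l (1, r 1))) = _
    rw [scaleAut_embCu, toAdd_one, mul_zero, MulAut.conj_apply, conj_xElt_embCu_r, map_one, one_mul, zero_sub, neg_neg,
      ofAdd_toAdd, ← embCu_eq_mul]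
  obtain ⟨Γh, hΓh⟩ := exists_completion_of_mulEquiv l Γ₀
  have hzc : ∀ c : Multiplicative (ZMod l), (Γh.trans Sg) (toHat l (embCu l (c, 1))) = γ ⟨toHat l (embCu l (c, 1)), hzcA c⟩ :=
    fun c => by
    rw [ContinuousMulEquiv.trans_apply, hΓh, hΓ₀z, apply_zc_of_scaling l Sg u hSinl, aut_apply_zc l hzcA γ k hk c]
  have ht : ∀ j : ℤ, (Γh.trans Sg) (toHat l (embCu l (1, r 1) ^ j)) = γ ⟨toHat l (embCu l (1, r 1) ^ j), hRA (toHat_t_zpow_mem l hR j)⟩ := by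
    intro j
    have lhs : (Γh.trans Sg) (toHat l (embCu l (1, r 1) ^ j)) = (toHat l (embCu l (c₀, 1)) * x₀) ^ j := by
      rw [ContinuousMulEquiv.trans_apply, map_zpow (toHat l), map_zpow Γh, hΓh, hΓ₀t, map_mul (toHat l), map_zpow Sg, map_mul Sg,
        apply_zc_of_scaling l Sg u hSinl, hSR ⟨_, toHat_t_mem l hR⟩, hρfR, hfRt]
    have em : (⟨toHat l (embCu l (1, r 1) ^ j), hRA (toHat_t_zpow_mem l hR j)⟩ : ↥A) = ⟨toHat l (embCu l (1, r 1)), htA⟩ ^ j :=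
      Subtype.ext (by simp only [SubgroupClass.coe_zpow, map_zpow])
    rw [lhs, em, map_zpow, SubgroupClass.coe_zpow, h0]
  refine ⟨Γh.trans Sg, ?_, ?_, ?_, ?_⟩
  · intro h
    subst hA
    have key := eq_of_eqOn_subgroup_of_continuous ((((heisB0 l ⊓ heisPiX l).comap (PhiT l)) ⊓ PiCdotT l).map (toHat l).toMonoidHom)
      (f := fun h => (Γh.trans Sg) (h : PiC l)) (g := fun h => (γ h : PiC l))
      ((map_continuous _).comp continuous_subtype_val) (continuous_subtype_val.comp γ.continuous) ?_
    · exact congrFun key h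
    · intro q hq
      have hqA : q ∈ (((((heisB0 l ⊓ heisPiX l).comap (PhiT l))) ⊓ PiCdotT l).map (toHat l).toMonoidHom).topologicalClosure :=
        Subgroup.le_topologicalClosure _ hq
      obtain ⟨g, hg, rfl⟩ := hq
      obtain ⟨c, j, rfl⟩ := (mem_dotXu_iff l g).mp hg
      change (Γh.trans Sg) (toHat l (embCu l (ofAdd c, r j))) = γ ⟨toHat l (embCu l (ofAdd c, r j)), hqA⟩
      have e := embCu_eq_mul l (ofAdd c) (r j)
      have e' := (embCu_one_dihedral l j).1
      have hm : (⟨toHat l (embCu l (ofAdd c, r j)), hqA⟩ :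
          ↥((((heisB0 l ⊓ heisPiX l).comap (PhiT l)) ⊓ PiCdotT l).map (toHat l).toMonoidHom).topologicalClosure) =
          ⟨toHat l (embCu l (ofAdd c, 1)), hzcA _⟩ * ⟨toHat l (embCu l (1, r 1) ^ (show ℤ from j)), hRA (toHat_t_zpow_mem l hR _)⟩ :=
        Subtype.ext (by
          change toHat l (embCu l (ofAdd c, r j)) = toHat l (embCu l (ofAdd c, 1)) * toHat l (embCu l (1, r 1) ^ (show ℤ from j))
          rw [e, e', map_mul])
      rw [hm, map_mul, Subgroup.coe_mul, ← hzc, ← ht, ← map_mul, ← map_mul, ← e', ← e]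
  · rw [hA] at hSA ⊢
    exact map_ctrans_eq l _ _ _ (map_closure_eq_of_completion l Γh Γ₀ hΓh _ (by
      rw [Subgroup.map_inf_eq _ _ Γ₀.toMonoidHom Γ₀.injective]
      refine congrArg₂ (· ⊓ ·) (map_trans_eq _ _ _ ?_ (conj_xElt_stabilises l _).1)
        (map_trans_eq _ _ _ (scaleAut_stabilises l uk).2.2.2 (conj_xElt_stabilises l _).2)
      rw [Subgroup.comap_inf, Subgroup.map_inf_eq _ _ (scaleAut l uk).toMonoidHom (scaleAut l uk).injective,
        (scaleAut_stabilises l uk).1, (scaleAut_stabilises l uk).2.2.1])) hSA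
  · exact map_ctrans_eq l _ _ _ (map_closure_eq_of_completion l Γh Γ₀ hΓh _ (map_trans_eq _ _ _ (by
        rw [Subgroup.comap_inf, Subgroup.map_inf_eq _ _ (scaleAut l uk).toMonoidHom (scaleAut l uk).injective,
          (scaleAut_stabilises l uk).1, (scaleAut_stabilises l uk).2.2.1]) (conj_xElt_stabilises l _).1))
      (hSstab _ hAc)
  · exact map_ctrans_eq l _ _ _ (map_closure_eq_of_completion l Γh Γ₀ hΓh _
      (map_trans_eq _ _ _ (scaleAut_stabilises l uk).2.2.2 (conj_xElt_stabilises l _).2)) (hSstab _ (coordClosed_PiCdotT l))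

/-- **[EtTh] Prop. 2.6, LAST SENTENCE, AS TYPED (`TemperedCoverData.Prop26_profinite`, FACT-LIST F-0611) HOLDS at the monodromy
model**, for every odd `l`: every topological automorphism of the PROFINITE `Π_{Ẋ̲̲}`, `Π_{Ẋ̲}`, `Π_{Ċ̲̲}`, `Π_{Ċ̲}` (closures in
`Π_C = (Π^tp_C)^∧` of the images of the dotted members) extends to a topological automorphism of `Π_C` stabilising the closures of the dotted
member, of the undotted member and of `Π_Ċ`. First INHABITED instance of the F-0611 instance form in the tree (its universal closure is
REFUTED, abc-iut-f-143 `TemperedModel.not_forall_prop26_profinite`; it FAILS at the NV-L2 model of record). Obtained WITHOUT coordinates on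
Mathlib's abstract completion: scaling automorphisms from the universal property (parts 2–3), torsion-freeness of the rotation closure from
simultaneous approximation in finite quotients (part 4), and the tempered generators `scaleAut`, `halfShift`, `conj(x^a)` of abc-iut-w6-d084
completed along `η`. CONSISTENCY of the typed interface + typed profinite Prop. 2.6 at OUR DESIGNED carrier only; nothing about print's
Prop. 2.6 (absolute anabelian geometry of a `K`-core); typed ≠ proved; no side taken on [IUTchIII] Cor. 3.12.
[cite: MochizukiEtTh2009, Prop 2.6 p.40] -/
theorem prop26_profinite_monodromyModel [NeZero l] (hl : Odd l) : (monodromyModel l hl).Prop26_profinite := by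
  intro Z hZ γ
  have finish : ∀ Γ : PiC l ≃ₜ* PiC l,
      (((Z ⊓ PiCdotT l).map (toHat l).toMonoidHom).topologicalClosure).map Γ.toMulEquiv.toMonoidHom =
        ((Z ⊓ PiCdotT l).map (toHat l).toMonoidHom).topologicalClosure →
      ((Z.map (toHat l).toMonoidHom).topologicalClosure).map Γ.toMulEquiv.toMonoidHom =
        (Z.map (toHat l).toMonoidHom).topologicalClosure →
      (((PiCdotT l).map (toHat l).toMonoidHom).topologicalClosure).map Γ.toMulEquiv.toMonoidHom =
        ((PiCdotT l).map (toHat l).toMonoidHom).topologicalClosure →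
      ∀ S ∈ [Z ⊓ (monodromyModel l hl).PiCdot, Z, (monodromyModel l hl).PiCdot],
        ((S.map (monodromyModel l hl).toHat).topologicalClosure).map Γ.toMulEquiv.toMonoidHom =
          (S.map (monodromyModel l hl).toHat).topologicalClosure := by
    intro Γ h1 h2 h3 S hS
    simp only [List.mem_cons, List.mem_nil_iff, or_false] at hS
    rcases hS with rfl | rfl | rfl
    exacts [h1, h2, h3]
  simp only [List.mem_cons, List.mem_nil_iff, or_false] at hZ
  rcases hZ with rfl | rfl | rfl | rfl
  · obtain ⟨Γ, hΓ, h1, h2, h3⟩ := exists_hatExtension_dotXuu l (tp_PiXuu l hl) rfl γ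
    exact ⟨Γ, hΓ, finish Γ h1 h2 h3⟩
  · obtain ⟨Γ, hΓ, h1, h2, h3⟩ := exists_hatExtension_dotXu l (tp_PiXu l hl) rfl γ
    exact ⟨Γ, hΓ, finish Γ h1 h2 h3⟩
  · obtain ⟨Γ, hΓ, h1, h2, h3⟩ := exists_hatExtension_dotCuu l hl (tp_PiCuu l hl) rfl γ
    exact ⟨Γ, hΓ, finish Γ h1 h2 h3⟩
  · obtain ⟨Γ, hΓ, h1, h2, h3⟩ := exists_hatExtension_dotCu l hl (tp_PiCu l hl) rfl γ
    exact ⟨Γ, hΓ, finish Γ h1 h2 h3⟩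

/-- **The instance form of F-0611 is INHABITED jointly with the tempered F-0610 and `K ⊇ μ_l`**: at `monodromyModel l hl` the typed
Prop. 2.6 holds for BOTH the tempered and the profinite fundamental groups of the dotted members (abc-iut-w6-d084's `prop26_monodromyModel`,
this file), with `HasMuL`. (consistency witness for the typed interface; no claim about print) [cite: MochizukiEtTh2009, Prop 2.6 p.40] -/
theorem exists_temperedCoverData_prop26_profinite [NeZero l] (hl : Odd l) :
    ∃ T : TemperedCoverData.{0} l, T.Prop26_profinite ∧ T.Prop26 ∧ T.HasMuL :=
  ⟨monodromyModel l hl, prop26_profinite_monodromyModel l hl, prop26_monodromyModel l hl, hasMuL_monodromyModel l hl⟩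

/-- **Census pair for F-0611 / node EtTh:Prop2.6 (profinite clause)**: the instance form of the typed profinite Prop. 2.6 is INHABITED
(monodromy model, this file) while its universal closure over the interface is REFUTED (abc-iut-f-143's
`TemperedModel.not_forall_prop26_profinite`, the NV-L2 toy of record), for every odd `l ≠ 1`: the schema is neither a theorem nor vacuous
over the typed interface. (no claim about print; refuted-as-typed ≠ refuted-in-print) [cite: MochizukiEtTh2009, Prop 2.6 p.40] -/
theorem prop26_profinite_instance_inhabited_and_closure_refuted [NeZero l] (hl : Odd l) (hl1 : l ≠ 1) :
    (∃ T : TemperedCoverData.{0} l, T.Prop26_profinite ∧ T.Prop26 ∧ T.HasMuL) ∧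
      ¬ ∀ T : TemperedCoverData.{0} l, T.Prop26_profinite :=
  ⟨exists_temperedCoverData_prop26_profinite l hl, TemperedModel.not_forall_prop26_profinite l hl hl1⟩

/-- CLOSED twin at `l = 3`. (no claim about print) [cite: MochizukiEtTh2009, Prop 2.6 p.40] -/
theorem prop26_profinite_monodromyModel_three :
    (monodromyModel 3 (by decide : Odd 3)).Prop26_profinite :=
  prop26_profinite_monodromyModel 3 (by decide)

end Cases






end Literature.AnabelianGeometry.EtaleTheta.ThetaCovers.MonodromyModel

end
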